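import Literature.NumberTheory.Sieve.MaynardNFSieve
import Literature.NumberTheory.Sieve.MaynardNFDiagonal
import HarnessLib

/-!
# The Maynard–Tao sieve over `𝓞_K`: Proposition 2.1, the `S₁` asymptotic, proved

Topic `Literature/NumberTheory/Sieve`. A. Castillo, C. Hall, R. J. Lemke Oliver, P. Pollack,
L. Thompson, *Bounded gaps between primes in number fields and function fields*, Proc. AMS 143 (2015)
= arXiv:1403.5808, Proposition 2.1 (`S₁` part) = Lemma 2.2 + "exactly the same reasoning as
Maynard's proofs of Lemmas 6.1 and 6.2": for the smooth weights of §2.2 with modulus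
`𝔴(N) = ∏_{N𝔭 ≤ log log log N} 𝔭`, level `R = |A(N)|^{θ/2−δ}` (`0 < δ`, `0 < θ/2 − δ`, `θ ≤ 1/2`),
distinct shifts and a continuous `G` (`F = 1_{R_k} G`),
`S₁ = (1 + o(1)) φ(𝔴)^k |A(N)| (c_K log R)^k I_k(F)/N𝔴^{k+1}`.
This file PROVES the statement `S1Asymptotic` of `MaynardNFSieve` for totally real `K`:

* parameter asymptotics along `N`: `dsum_paramW_eq`, `eventually_exp_mul_paramD0_le`,
  `tendsto_eps_param`, `tendsto_E_param`, `cardA`-versus-`(2N)^d` bounds;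
* `abs_S1_sub_main_eventually_le` — Lemma 2.2 in the form
  `|S₁ − (|A(N)|/N𝔴) ∑_𝔲 y_𝔲²/∏φ(𝔲ᵢ)| ≤ g(N) 𝔐(N)` with `g → 0`;
* **`S1_asymptotic`** — Proposition 2.1 (`S₁`): `S1Asymptotic K k h θ δ G v₀`.

## References

* Castillo–Hall–Lemke Oliver–Pollack–Thompson, arXiv:1403.5808, Lemma 2.2 and Proposition 2.1.
  [CastilloEtAl2015]
* J. Maynard, *Small gaps between primes*, Ann. of Math. 181 (2015), Lemmas 5.1, 6.2.
  [MaynardAnnals2015]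
-/

noncomputable section

open Finset Filter Topology Asymptotics UniqueFactorizationMonoid NumberField MeasureTheory
  IsDedekindDomain
open scoped NumberField Classical

namespace Literature.NumberTheory.Sieve.MaynardNF

open Literature.NumberTheory.LFunctions Literature.NumberTheory.LFunctions.NumberField
  Literature.NumberTheory.Sieve.MaynardTao Literature.NumberTheory.Sieve.IdealSieve Module

open scoped nonZeroDivisors

variable {K : Type*} [Field K] [NumberField K]
variable {k : ℕ}

/-! ### The parameters along `N` -/

/-- `∑_{𝔢∣𝔴(N)} μ(𝔢)/N𝔢 = φ(𝔴(N))/N𝔴(N)`. [folklore] -/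
theorem dsum_paramW_eq (N : ℝ) :
    ∑ 𝔢 ∈ idealDivisors K (paramW K N), (idealMoebius 𝔢 : ℝ) / Ideal.absNorm 𝔢 =
      idealTotient K (paramW K N) / (Ideal.absNorm (paramW K N) : ℝ) := by
  rw [dsum_eq_prod_one_sub_inv (paramW_ne_bot N), toFinset_normalizedFactors_paramW,
    idealTotient_paramW_div_eq]

/-- `φ(𝔴)/N𝔴 ≤ 1`. [folklore] -/
theorem idealTotient_div_absNorm_le_one {𝔴 : Ideal (𝓞 K)} (h𝔴 : 𝔴 ≠ ⊥) :
    idealTotient K 𝔴 / (Ideal.absNorm 𝔴 : ℝ) ≤ 1 := by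
  have hN : (0 : ℝ) < Ideal.absNorm 𝔴 := by
    exact_mod_cast Nat.pos_of_ne_zero (by rwa [Ne, Ideal.absNorm_eq_zero_iff])
  rw [div_le_one hN]
  exact idealTotient_le_absNorm 𝔴

/-- **`e^{c D₀(N)} ≤ (log N)^ε` eventually** (`D₀ = log log log N`, so `e^{c D₀} = (log log N)^c`).
[folklore] -/
theorem eventually_exp_mul_paramD0_le (c : ℝ) {ε : ℝ} (hε : 0 < ε) :
    ∀ᶠ N : ℝ in atTop, Real.exp (c * paramD0 N) ≤ Real.log N ^ ε := by
  -- `(log y)^c ≤ y^ε` for large `y = log N`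
  have h := isLittleO_log_rpow_rpow_atTop c hε
  have h1 : ∀ᶠ y : ℝ in atTop, Real.log y ^ c ≤ y ^ ε := by
    filter_upwards [h.bound one_pos, eventually_ge_atTop 1] with y hy hy1
    rw [one_mul, Real.norm_of_nonneg (Real.rpow_nonneg (Real.log_nonneg hy1) c),
      Real.norm_of_nonneg (Real.rpow_nonneg (by linarith) ε)] at hy
    exact hy
  have h2 := Real.tendsto_log_atTop.eventually h1
  have h3 : ∀ᶠ N : ℝ in atTop, 1 < Real.log (Real.log N) :=
    (Real.tendsto_log_atTop.comp Real.tendsto_log_atTop).eventually_gt_atTop 1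
  filter_upwards [h2, h3] with N hN hll
  rw [paramD0, ← Real.log_rpow (by linarith), Real.exp_log (Real.rpow_pos_of_pos (by linarith) c)]
  exact hN

/-- `(1 + x)^j ≤ e^{jx}` for `x ≥ 0`. [folklore] -/
theorem one_add_pow_le_exp_mul {x : ℝ} (hx : 0 ≤ x) (j : ℕ) : (1 + x) ^ j ≤ Real.exp (j * x) := by
  rw [Real.exp_nat_mul]
  exact pow_le_pow_left₀ (by linarith) (by linarith [Real.add_one_le_exp x]) j

/-- **`ε(N) → 0`**: `D₀^{-1/4} N𝔴/φ(𝔴) ≤ C log D₀ · D₀^{-1/4} → 0`. [cite: CastilloEtAl2015, §2.2] -/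
theorem tendsto_eps_param :
    Tendsto (fun N : ℝ => paramD0 N ^ (-(1 : ℝ) / 4) /
      ∑ 𝔢 ∈ idealDivisors K (paramW K N), (idealMoebius 𝔢 : ℝ) / Ideal.absNorm 𝔢) atTop (𝓝 0) := by
  obtain ⟨Cφ, hCφ0, hCφ⟩ := one_div_le_idealTotient_paramW_div (K := K)
  -- the majorant `Cφ log D₀ · D₀^{-1/4} → 0`
  have hmaj : Tendsto (fun N : ℝ => Cφ * (Real.log (paramD0 N) * paramD0 N ^ (-(1 : ℝ) / 4)))
      atTop (𝓝 0) := by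
    have h1 := (isLittleO_log_rpow_atTop (by norm_num : (0 : ℝ) < 1 / 4)).tendsto_div_nhds_zero
    have h2 := (h1.comp tendsto_paramD0_atTop).const_mul Cφ
    rw [mul_zero] at h2
    refine h2.congr' ?_
    filter_upwards [tendsto_paramD0_atTop.eventually_ge_atTop 1] with N hN
    simp only [Function.comp]
    rw [div_eq_mul_inv, ← Real.rpow_neg (by linarith)]
    norm_num
  refine squeeze_zero' ?_ ?_ hmaj
  · filter_upwards [tendsto_paramD0_atTop.eventually_ge_atTop 2] with N hN
    have hlogD : 0 < Real.log (paramD0 N) := Real.log_pos (by linarith)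
    have hd : 0 < ∑ 𝔢 ∈ idealDivisors K (paramW K N), (idealMoebius 𝔢 : ℝ) / Ideal.absNorm 𝔢 := by
      rw [dsum_paramW_eq]
      exact lt_of_lt_of_le (one_div_pos.2 (mul_pos hCφ0 hlogD)) (hCφ N hN)
    positivity
  · filter_upwards [tendsto_paramD0_atTop.eventually_ge_atTop 2] with N hN
    have hlog : 0 < Real.log (paramD0 N) := Real.log_pos (by linarith)
    have hφ := hCφ N hN
    rw [dsum_paramW_eq]
    have hd : 0 < idealTotient K (paramW K N) / (Ideal.absNorm (paramW K N) : ℝ) :=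
      lt_of_lt_of_le (by positivity) hφ
    rw [div_le_iff₀ hd]
    calc paramD0 N ^ (-(1 : ℝ) / 4) = paramD0 N ^ (-(1 : ℝ) / 4) * (Cφ * Real.log (paramD0 N)) *
          (1 / (Cφ * Real.log (paramD0 N))) := by field_simp
      _ ≤ paramD0 N ^ (-(1 : ℝ) / 4) * (Cφ * Real.log (paramD0 N)) *
          (idealTotient K (paramW K N) / (Ideal.absNorm (paramW K N) : ℝ)) :=
          mul_le_mul_of_nonneg_left hφ (by positivity)
      _ = _ := by ring

/-- The divisors of `𝔴 ≠ 0` have norm `≤ N𝔴`. [folklore] -/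
theorem idealDivisors_subset_idealsLE {𝔴 : Ideal (𝓞 K)} (h𝔴 : 𝔴 ≠ ⊥) :
    idealDivisors K 𝔴 ⊆ idealsLE K (Ideal.absNorm 𝔴 : ℝ) := by
  intro 𝔢 h𝔢
  have hdvd := (mem_idealDivisors h𝔴).1 h𝔢
  have h0 := ne_bot_of_mem_idealDivisors h𝔴 h𝔢
  rw [mem_idealsLE]
  refine ⟨h0, ?_⟩
  have hN0 : Ideal.absNorm 𝔴 ≠ 0 := by rwa [Ne, Ideal.absNorm_eq_zero_iff]
  exact_mod_cast Nat.le_of_dvd (Nat.pos_of_ne_zero hN0) (map_dvd _ hdvd)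

/-- `∑_{𝔢∣𝔴} (1 + log N𝔢)/N𝔢 ≤ (1 + log N𝔴)(c_K log N𝔴 + C_h)` (harmonic sum over all ideals of norm
`≤ N𝔴`). [folklore] -/
theorem divisorLogSum_le :
    ∃ Ch : ℝ, 0 ≤ Ch ∧ ∀ 𝔴 : Ideal (𝓞 K), 𝔴 ≠ ⊥ →
      ∑ 𝔢 ∈ idealDivisors K 𝔴, (1 + Real.log (Ideal.absNorm 𝔢)) / Ideal.absNorm 𝔢 ≤
        (1 + Real.log (Ideal.absNorm 𝔴)) *
          (dedekindZeta_residue K * Real.log (Ideal.absNorm 𝔴) + Ch) := by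
  obtain ⟨Ch, hCh⟩ := abs_harmonic_sub_log_le K
  have hCh0 : 0 ≤ Ch := (abs_nonneg _).trans (hCh 1 le_rfl)
  refine ⟨Ch, hCh0, fun 𝔴 h𝔴 => ?_⟩
  have hN1 : (1 : ℝ) ≤ Ideal.absNorm 𝔴 := by
    exact_mod_cast Nat.one_le_iff_ne_zero.2 (by rwa [Ne, Ideal.absNorm_eq_zero_iff])
  have hlogw : 0 ≤ Real.log (Ideal.absNorm 𝔴 : ℝ) := Real.log_nonneg hN1
  -- termwise: `(1 + log N𝔢)/N𝔢 ≤ (1 + log N𝔴) · N𝔢⁻¹`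
  have hterm : ∀ 𝔢 ∈ idealDivisors K 𝔴, (1 + Real.log (Ideal.absNorm 𝔢)) / Ideal.absNorm 𝔢 ≤
      (1 + Real.log (Ideal.absNorm 𝔴)) * ((Ideal.absNorm 𝔢 : ℕ) : ℝ)⁻¹ := by
    intro 𝔢 h𝔢
    have hle := (mem_idealsLE.1 (idealDivisors_subset_idealsLE h𝔴 h𝔢)).2
    have h1 : (1 : ℝ) ≤ Ideal.absNorm 𝔢 := one_le_absNorm_of_mem_idealsLE (idealDivisors_subset_idealsLE h𝔴 h𝔢)
    rw [div_eq_mul_inv]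
    refine mul_le_mul_of_nonneg_right ?_ (by positivity)
    exact add_le_add le_rfl (Real.log_le_log (by linarith) hle)
  refine (Finset.sum_le_sum hterm).trans ?_
  rw [← Finset.mul_sum]
  refine mul_le_mul_of_nonneg_left ?_ (by linarith)
  have hsub := idealDivisors_subset_idealsLE h𝔴 (K := K)
  calc ∑ 𝔢 ∈ idealDivisors K 𝔴, ((Ideal.absNorm 𝔢 : ℕ) : ℝ)⁻¹
      ≤ ∑ 𝔢 ∈ idealsLE K (Ideal.absNorm 𝔴 : ℝ), ((Ideal.absNorm 𝔢 : ℕ) : ℝ)⁻¹ :=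
        Finset.sum_le_sum_of_subset_of_nonneg hsub fun _ _ _ => by positivity
    _ ≤ dedekindZeta_residue K * Real.log (Ideal.absNorm 𝔴) + Ch := by
        have h := hCh (Ideal.absNorm 𝔴 : ℝ) hN1
        linarith [(abs_sub_le_iff.1 h).1]

/-- `log|A(N)| ≥ (1/2) log N` eventually, for totally real `K` (`|A(N)| ≫ N^d ≥ N`). [folklore] -/
theorem eventually_half_log_le_log_cardA [IsTotallyReal K] :
    ∀ᶠ N : ℝ in atTop, 1 / 2 * Real.log N ≤ Real.log (cardA K N) := by
  have hAdiv := tendsto_cardA_div (K := K)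
  set d : ℕ := finrank ℚ K with hd
  have hd1 : 1 ≤ d := finrank_pos
  set ℓ : ℝ := (1 - 2⁻¹ ^ d) / √|(discr K : ℝ)| with hℓ
  have hℓ0 : 0 < ℓ := by
    have hD : 0 < √|(discr K : ℝ)| := Real.sqrt_pos.2 (abs_pos.2 (Int.cast_ne_zero.2 (discr_ne_zero K)))
    have h2d : (0 : ℝ) < 1 - 2⁻¹ ^ d := by
      rw [sub_pos]; exact pow_lt_one₀ (by norm_num) (by norm_num) (by omega)
    positivity
  have h1 : ∀ᶠ N : ℝ in atTop, ℓ / 2 ≤ (cardA K N : ℝ) / (2 * N) ^ d :=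
    hAdiv.eventually (eventually_ge_nhds (by linarith))
  filter_upwards [h1, eventually_ge_atTop (1 : ℝ),
    Real.tendsto_log_atTop.eventually_ge_atTop (-2 * Real.log ℓ)] with N h1 hN1 hNℓ
  have hN0 : 0 < N := by linarith
  have h2N : (0 : ℝ) < (2 * N) ^ d := by positivity
  rw [le_div_iff₀ h2N] at h1
  have h2Nd : 2 * N ≤ (2 * N) ^ d := by
    calc 2 * N = (2 * N) ^ 1 := (pow_one _).symm
      _ ≤ (2 * N) ^ d := pow_le_pow_right₀ (by linarith) hd1
  have hA : ℓ * N ≤ cardA K N := by nlinarith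
  have hlog : Real.log ℓ + Real.log N ≤ Real.log (cardA K N) := by
    rw [← Real.log_mul hℓ0.ne' hN0.ne']
    exact Real.log_le_log (by positivity) hA
  linarith

/-- **`E(N)/(c log R) → 0`**: the ratio `(1 + ∑_{𝔢∣𝔴}(1 + log N𝔢)/N𝔢)/((φ(𝔴)/N𝔴) log R)` tends to
`0` along `𝔴 = 𝔴(N)`, `R = |A(N)|^{θ/2−δ}` (numerator `≪ (1 + D₀)² ≤ e^{2D₀}`, `N𝔴/φ(𝔴) ≪ log D₀ ≤ e^{D₀}`,
`e^{3D₀} ≤ (log N)^{1/2}`, `log R ≫ log N`). [cite: CastilloEtAl2015, §2.2 and proof of Proposition 2.1] -/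
theorem tendsto_E_param [IsTotallyReal K] {θ δ : ℝ} (hη : 0 < θ / 2 - δ) :
    Tendsto (fun N : ℝ =>
      (1 + ∑ 𝔢 ∈ idealDivisors K (paramW K N), (1 + Real.log (Ideal.absNorm 𝔢)) / Ideal.absNorm 𝔢) /
        ((∑ 𝔢 ∈ idealDivisors K (paramW K N), (idealMoebius 𝔢 : ℝ) / Ideal.absNorm 𝔢) *
          Real.log (nfR K θ δ N))) atTop (𝓝 0) := by
  obtain ⟨Cφ, hCφ0, hCφ⟩ := one_div_le_idealTotient_paramW_div (K := K)
  obtain ⟨Cw, hCw0, hCw⟩ := log_absNorm_paramW_le (K := K)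
  obtain ⟨Ch, hCh0, hCh⟩ := divisorLogSum_le (K := K)
  have hρ0 : 0 < dedekindZeta_residue K := dedekindZeta_residue_pos K
  obtain ⟨Knum, hKnum⟩ : ∃ x : ℝ, x = (1 + Cw) * (dedekindZeta_residue K * Cw + Ch + 1) := ⟨_, rfl⟩
  have hKnum0 : 0 < Knum := by rw [hKnum]; positivity
  obtain ⟨B, hB⟩ : ∃ x : ℝ, x = Knum * Cφ / ((θ / 2 - δ) / 2) := ⟨_, rfl⟩
  have hB0 : 0 ≤ B := by rw [hB]; positivity
  have hA := tendsto_cardA_atTop (K := K)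
  -- the bound, eventually
  have hkey : ∀ᶠ N : ℝ in atTop,
      (1 + ∑ 𝔢 ∈ idealDivisors K (paramW K N), (1 + Real.log (Ideal.absNorm 𝔢)) / Ideal.absNorm 𝔢) /
        ((∑ 𝔢 ∈ idealDivisors K (paramW K N), (idealMoebius 𝔢 : ℝ) / Ideal.absNorm 𝔢) *
          Real.log (nfR K θ δ N)) ≤ B * Real.log N ^ (-(1 : ℝ) / 2) := by
    filter_upwards [tendsto_paramD0_atTop.eventually_ge_atTop 2, eventually_half_log_le_log_cardA (K := K),
      eventually_exp_mul_paramD0_le 3 (by norm_num : (0 : ℝ) < 1 / 2),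
      eventually_gt_atTop (1 : ℝ), hA.eventually_gt_atTop 0] with N hD2 hlogAN hexp hN1 hA0
    have hD0 : 0 ≤ paramD0 N := by linarith
    have hlogN : 0 < Real.log N := Real.log_pos hN1
    obtain ⟨D₀, hD₀⟩ : ∃ x : ℝ, x = paramD0 N := ⟨_, rfl⟩
    rw [← hD₀] at hD2 hD0 hexp
    have h𝔴0 : paramW K N ≠ ⊥ := paramW_ne_bot N
    -- numerator `≤ Knum e^{2D₀}`
    have hnum0 : 0 ≤ 1 + ∑ 𝔢 ∈ idealDivisors K (paramW K N),
        (1 + Real.log (Ideal.absNorm 𝔢)) / Ideal.absNorm 𝔢 := by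
      refine add_nonneg zero_le_one (Finset.sum_nonneg fun 𝔢 h𝔢 => ?_)
      have h1 : (1 : ℝ) ≤ Ideal.absNorm 𝔢 :=
        one_le_absNorm_of_mem_idealsLE (idealDivisors_subset_idealsLE h𝔴0 h𝔢)
      have := Real.log_nonneg h1
      positivity
    have hnum : 1 + ∑ 𝔢 ∈ idealDivisors K (paramW K N), (1 + Real.log (Ideal.absNorm 𝔢)) / Ideal.absNorm 𝔢 ≤
        Knum * Real.exp (2 * D₀) := by
      have h1 := hCh (paramW K N) h𝔴0
      have hlw : Real.log (Ideal.absNorm (paramW K N) : ℝ) ≤ Cw * D₀ := by rw [hD₀]; exact hCw N (hD₀ ▸ hD2)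
      have hlw0 : 0 ≤ Real.log (Ideal.absNorm (paramW K N) : ℝ) := Real.log_nonneg (by
        exact_mod_cast Nat.one_le_iff_ne_zero.2 (by rw [Ne, Ideal.absNorm_eq_zero_iff]; exact h𝔴0))
      obtain ⟨lw, hlwdef⟩ : ∃ x : ℝ, x = Real.log (Ideal.absNorm (paramW K N) : ℝ) := ⟨_, rfl⟩
      rw [← hlwdef] at h1 hlw hlw0
      have hρlw : dedekindZeta_residue K * lw ≤ dedekindZeta_residue K * (Cw * D₀) :=
        mul_le_mul_of_nonneg_left hlw hρ0.le
      have hCD : 0 ≤ Cw * D₀ := mul_nonneg hCw0 hD0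
      have h2 : (1 + lw) * (dedekindZeta_residue K * lw + Ch) ≤
          (1 + Cw * D₀) * (dedekindZeta_residue K * (Cw * D₀) + Ch) :=
        mul_le_mul (by linarith) (by linarith) (by positivity) (by linarith)
      have ha : 1 + Cw * D₀ ≤ (1 + Cw) * (1 + D₀) := by
        have e : (1 + Cw) * (1 + D₀) = 1 + Cw * D₀ + (Cw + D₀) := by ring
        rw [e]; linarith
      have hb : dedekindZeta_residue K * (Cw * D₀) + Ch + 1 ≤
          (dedekindZeta_residue K * Cw + Ch + 1) * (1 + D₀) := by
        have e : (dedekindZeta_residue K * Cw + Ch + 1) * (1 + D₀) =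
            dedekindZeta_residue K * (Cw * D₀) + Ch + 1 + (dedekindZeta_residue K * Cw + Ch * D₀ + D₀) := by
          ring
        rw [e]
        have : 0 ≤ dedekindZeta_residue K * Cw + Ch * D₀ + D₀ := by positivity
        linarith
      have hc : (1 + Cw * D₀) * (dedekindZeta_residue K * (Cw * D₀) + Ch) + 1 ≤
          (1 + Cw * D₀) * (dedekindZeta_residue K * (Cw * D₀) + Ch + 1) := by
        have e : (1 + Cw * D₀) * (dedekindZeta_residue K * (Cw * D₀) + Ch + 1) =
            (1 + Cw * D₀) * (dedekindZeta_residue K * (Cw * D₀) + Ch) + 1 + Cw * D₀ := by ring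
        rw [e]; linarith
      have hdprod : (1 + Cw * D₀) * (dedekindZeta_residue K * (Cw * D₀) + Ch + 1) ≤
          ((1 + Cw) * (1 + D₀)) * ((dedekindZeta_residue K * Cw + Ch + 1) * (1 + D₀)) :=
        mul_le_mul ha hb (by positivity) (by positivity)
      have h4 : (1 + D₀) ^ 2 ≤ Real.exp (2 * D₀) := by
        have := one_add_pow_le_exp_mul hD0 2
        norm_num at this
        exact this
      calc 1 + ∑ 𝔢 ∈ idealDivisors K (paramW K N), (1 + Real.log (Ideal.absNorm 𝔢)) / Ideal.absNorm 𝔢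
          ≤ (1 + Cw * D₀) * (dedekindZeta_residue K * (Cw * D₀) + Ch) + 1 := by linarith
        _ ≤ ((1 + Cw) * (1 + D₀)) * ((dedekindZeta_residue K * Cw + Ch + 1) * (1 + D₀)) := hc.trans hdprod
        _ = Knum * (1 + D₀) ^ 2 := by rw [hKnum]; ring
        _ ≤ Knum * Real.exp (2 * D₀) := mul_le_mul_of_nonneg_left h4 hKnum0.le
    -- denominator `≥ (η/2) log N/(Cφ e^{D₀})`
    have hφ : 1 / (Cφ * Real.log D₀) ≤
        idealTotient K (paramW K N) / (Ideal.absNorm (paramW K N) : ℝ) := by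
      rw [hD₀]; exact hCφ N (hD₀ ▸ hD2)
    have hdsum : ∑ 𝔢 ∈ idealDivisors K (paramW K N), (idealMoebius 𝔢 : ℝ) / Ideal.absNorm 𝔢 =
        idealTotient K (paramW K N) / (Ideal.absNorm (paramW K N) : ℝ) := dsum_paramW_eq N
    have hlogD0 : 0 < Real.log D₀ := Real.log_pos (by linarith)
    have hdpos : 0 < idealTotient K (paramW K N) / (Ideal.absNorm (paramW K N) : ℝ) :=
      lt_of_lt_of_le (one_div_pos.2 (mul_pos hCφ0 hlogD0)) hφ
    have hlogD : Real.log D₀ ≤ Real.exp D₀ := by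
      have h1 : Real.log D₀ ≤ D₀ := (Real.log_le_sub_one_of_pos (by linarith)).trans (by linarith)
      exact h1.trans (by linarith [Real.add_one_le_exp D₀])
    have hinv : (Cφ * Real.exp D₀)⁻¹ ≤ idealTotient K (paramW K N) / (Ideal.absNorm (paramW K N) : ℝ) := by
      calc (Cφ * Real.exp D₀)⁻¹ = 1 / (Cφ * Real.exp D₀) := (one_div _).symm
        _ ≤ 1 / (Cφ * Real.log D₀) := by
            refine one_div_le_one_div_of_le (by positivity) ?_
            exact mul_le_mul_of_nonneg_left hlogD hCφ0.le
        _ ≤ _ := hφ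
    have hlogR : (θ / 2 - δ) / 2 * Real.log N ≤ Real.log (nfR K θ δ N) := by
      rw [log_nfR θ δ hA0]
      have := mul_le_mul_of_nonneg_left hlogAN hη.le
      linarith
    have hden0 : 0 < (Cφ * Real.exp D₀)⁻¹ * ((θ / 2 - δ) / 2 * Real.log N) := by positivity
    have hden : (Cφ * Real.exp D₀)⁻¹ * ((θ / 2 - δ) / 2 * Real.log N) ≤
        idealTotient K (paramW K N) / (Ideal.absNorm (paramW K N) : ℝ) * Real.log (nfR K θ δ N) :=
      mul_le_mul hinv hlogR (by positivity) hdpos.le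
    rw [hdsum]
    have hstep1 : (1 + ∑ 𝔢 ∈ idealDivisors K (paramW K N),
        (1 + Real.log (Ideal.absNorm 𝔢)) / Ideal.absNorm 𝔢) /
          (idealTotient K (paramW K N) / (Ideal.absNorm (paramW K N) : ℝ) * Real.log (nfR K θ δ N)) ≤
        (Knum * Real.exp (2 * D₀)) / ((Cφ * Real.exp D₀)⁻¹ * ((θ / 2 - δ) / 2 * Real.log N)) :=
      (div_le_div_of_nonneg_left hnum0 hden0 hden).trans (div_le_div_of_nonneg_right hnum hden0.le)
    refine hstep1.trans ?_
    have hexp3 : Real.exp (2 * D₀) * Real.exp D₀ ≤ Real.log N ^ (1 / 2 : ℝ) := by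
      rw [← Real.exp_add]
      have e : 2 * D₀ + D₀ = 3 * D₀ := by ring
      rw [e]; exact hexp
    have hCφne : Cφ ≠ 0 := hCφ0.ne'
    have hηne : (θ / 2 - δ) / 2 ≠ 0 := by positivity
    have hlogne : Real.log N ≠ 0 := hlogN.ne'
    have heq : (Knum * Real.exp (2 * D₀)) / ((Cφ * Real.exp D₀)⁻¹ * ((θ / 2 - δ) / 2 * Real.log N)) =
        B * (Real.exp (2 * D₀) * Real.exp D₀) / Real.log N := by
      rw [hB]
      field_simp
    rw [heq]
    calc B * (Real.exp (2 * D₀) * Real.exp D₀) / Real.log N ≤ B * Real.log N ^ (1 / 2 : ℝ) / Real.log N :=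
          div_le_div_of_nonneg_right (mul_le_mul_of_nonneg_left hexp3 hB0) hlogN.le
      _ = B * Real.log N ^ (-(1 : ℝ) / 2) := by
          rw [mul_div_assoc, ← Real.rpow_sub_one hlogne]
          norm_num
  -- the majorant tends to `0`
  have hmaj : Tendsto (fun N : ℝ => B * Real.log N ^ (-(1 : ℝ) / 2)) atTop (𝓝 0) := by
    have h1 : Tendsto (fun N : ℝ => Real.log N ^ (-(1 / 2 : ℝ))) atTop (𝓝 0) :=
      (tendsto_rpow_neg_atTop (by norm_num : (0 : ℝ) < 1 / 2)).comp Real.tendsto_log_atTop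
    have h2 := h1.const_mul B
    rw [mul_zero] at h2
    refine h2.congr' (Eventually.of_forall fun N => ?_)
    norm_num
  refine squeeze_zero' ?_ hkey hmaj
  filter_upwards [tendsto_paramD0_atTop.eventually_ge_atTop 2, hA.eventually_gt_atTop 1] with N hD2 hA1
  have hφ := hCφ N hD2
  have hlogD : 0 < Real.log (paramD0 N) := Real.log_pos (by linarith)
  have hdpos : 0 < ∑ 𝔢 ∈ idealDivisors K (paramW K N), (idealMoebius 𝔢 : ℝ) / Ideal.absNorm 𝔢 := by
    rw [dsum_paramW_eq]; exact lt_of_lt_of_le (one_div_pos.2 (mul_pos hCφ0 hlogD)) hφ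
  have hlogR : 0 < Real.log (nfR K θ δ N) := by
    rw [log_nfR θ δ (by linarith)]; exact mul_pos hη (Real.log_pos hA1)
  have hnum : 0 ≤ 1 + ∑ 𝔢 ∈ idealDivisors K (paramW K N),
      (1 + Real.log (Ideal.absNorm 𝔢)) / Ideal.absNorm 𝔢 := by
    refine add_nonneg zero_le_one (Finset.sum_nonneg fun 𝔢 h𝔢 => ?_)
    have h1 : (1 : ℝ) ≤ Ideal.absNorm 𝔢 :=
      one_le_absNorm_of_mem_idealsLE (idealDivisors_subset_idealsLE (paramW_ne_bot N) h𝔢)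
    have := Real.log_nonneg h1
    positivity
  exact div_nonneg hnum (mul_nonneg hdpos.le hlogR.le)


/-! ### Real-variable bookkeeping for the error terms of Lemma 2.2 -/

/-- Bookkeeping for the second error term of Lemma 2.2, (i): the power factors
`R² ≤ c₂ N^{d−1/2}` and `(N^d/w)^{1−1/d} (R²)^{1/d} ≤ c₂ N^{d−1/2}` (`R = A^{η₀}`, `2η₀ ≤ 1/2`, `A ≤ c₂ N^d`). [folklore] -/
theorem term2_pow_bounds {n : ℕ} {N A w R c₂ η₀ : ℝ}
    (hn : 1 ≤ n) (hN : 1 ≤ N) (hc₂ : 1 ≤ c₂) (hA₂ : A ≤ c₂ * N ^ n) (hA1 : 1 ≤ A)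
    (hη2 : 2 * η₀ ≤ 1 / 2) (hR : R = A ^ η₀) (hw1 : 1 ≤ w) :
    R ^ 2 ≤ c₂ * N ^ ((n : ℝ) - 1 / 2) ∧
      (N ^ n / w) ^ (1 - 1 / (n : ℝ)) * (R ^ 2) ^ (1 / (n : ℝ)) ≤ c₂ * N ^ ((n : ℝ) - 1 / 2) := by
  have hNpos : 0 < N := by linarith
  have hApos : 0 < A := by linarith
  have hnR : (1 : ℝ) ≤ n := by exact_mod_cast hn
  have hn0 : (0 : ℝ) < n := by linarith
  have hNn : (N : ℝ) ^ n = N ^ (n : ℝ) := (Real.rpow_natCast N n).symm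
  have hNn0 : 0 ≤ (N : ℝ) ^ n := by positivity
  have hc₂0 : 0 ≤ c₂ := by linarith
  -- `R² = A^{2η₀} ≤ A^{1/2}`
  have hR2 : R ^ 2 = A ^ (2 * η₀) := by
    rw [hR, ← Real.rpow_natCast (A ^ η₀) 2, ← Real.rpow_mul hApos.le, mul_comm]
    norm_num
  have hR2half : R ^ 2 ≤ A ^ (1 / 2 : ℝ) := by
    rw [hR2]; exact Real.rpow_le_rpow_of_exponent_le hA1 hη2
  have hc₂rpow : ∀ {e : ℝ}, e ≤ 1 → c₂ ^ e ≤ c₂ := fun he1 => by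
    calc c₂ ^ _ ≤ c₂ ^ (1 : ℝ) := Real.rpow_le_rpow_of_exponent_le hc₂ he1
      _ = c₂ := Real.rpow_one _
  constructor
  · calc R ^ 2 ≤ A ^ (1 / 2 : ℝ) := hR2half
      _ ≤ (c₂ * N ^ n) ^ (1 / 2 : ℝ) := Real.rpow_le_rpow hApos.le hA₂ (by norm_num)
      _ = c₂ ^ (1 / 2 : ℝ) * N ^ ((n : ℝ) / 2) := by
          rw [Real.mul_rpow hc₂0 hNn0, hNn, ← Real.rpow_mul hNpos.le]; ring_nf
      _ ≤ c₂ * N ^ ((n : ℝ) - 1 / 2) := by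
          refine mul_le_mul (hc₂rpow (by norm_num))
            (Real.rpow_le_rpow_of_exponent_le hN (by linarith)) (by positivity) hc₂0
  · have he0 : 0 ≤ 1 - 1 / (n : ℝ) := by
      rw [sub_nonneg, div_le_one hn0]; exact hnR
    have hpart1 : (N ^ n / w) ^ (1 - 1 / (n : ℝ)) ≤ N ^ ((n : ℝ) - 1) := by
      calc (N ^ n / w) ^ (1 - 1 / (n : ℝ)) ≤ (N ^ n) ^ (1 - 1 / (n : ℝ)) :=
            Real.rpow_le_rpow (by positivity) (div_le_self hNn0 hw1) he0
        _ = N ^ ((n : ℝ) - 1) := by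
            rw [hNn, ← Real.rpow_mul hNpos.le]
            congr 1
            field_simp
    have hpart2 : (R ^ 2) ^ (1 / (n : ℝ)) ≤ c₂ * N ^ (1 / 2 : ℝ) := by
      have h1 : (R ^ 2) ^ (1 / (n : ℝ)) = A ^ (2 * η₀ / n) := by
        rw [hR2, ← Real.rpow_mul hApos.le]; ring_nf
      have h2 : A ^ (2 * η₀ / n) ≤ A ^ (1 / (2 * n) : ℝ) := by
        refine Real.rpow_le_rpow_of_exponent_le hA1 ?_
        rw [div_le_div_iff₀ hn0 (by positivity)]
        nlinarith
      have h3 : A ^ (1 / (2 * n) : ℝ) ≤ (c₂ * N ^ n) ^ (1 / (2 * n) : ℝ) :=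
        Real.rpow_le_rpow hApos.le hA₂ (by positivity)
      have h4 : (c₂ * N ^ n) ^ (1 / (2 * n) : ℝ) = c₂ ^ (1 / (2 * n) : ℝ) * N ^ (1 / 2 : ℝ) := by
        rw [Real.mul_rpow hc₂0 hNn0, hNn, ← Real.rpow_mul hNpos.le]
        congr 2
        field_simp
      have h5 : c₂ ^ (1 / (2 * n) : ℝ) ≤ c₂ := hc₂rpow (by
        rw [div_le_one (by positivity)]; linarith)
      calc (R ^ 2) ^ (1 / (n : ℝ)) = A ^ (2 * η₀ / n) := h1
        _ ≤ c₂ ^ (1 / (2 * n) : ℝ) * N ^ (1 / 2 : ℝ) := by rw [← h4]; exact h2.trans h3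
        _ ≤ c₂ * N ^ (1 / 2 : ℝ) := mul_le_mul_of_nonneg_right h5 (by positivity)
    calc (N ^ n / w) ^ (1 - 1 / (n : ℝ)) * (R ^ 2) ^ (1 / (n : ℝ))
        ≤ N ^ ((n : ℝ) - 1) * (c₂ * N ^ (1 / 2 : ℝ)) :=
          mul_le_mul hpart1 hpart2 (by positivity) (by positivity)
      _ = c₂ * N ^ ((n : ℝ) - 1 / 2) := by
          rw [mul_left_comm, ← Real.rpow_add hNpos]; ring_nf

/-- Bookkeeping for the second error term of Lemma 2.2, (ii): the logarithmic factors. [folklore] -/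
theorem term2_log_bounds {k n : ℕ} {N R logR logN L LN LI Cu ymax cK c₂ CN CA Q : ℝ}
    (hlogN : 1 ≤ logN) (hCA : 0 ≤ CA) (hlogRN : logR ≤ CA * logN)
    (hcK : 0 < cK) (hL0 : 0 ≤ L) (hL : L ≤ 3 * cK * logR)
    (hCN : 0 ≤ CN) (hLN0 : 0 ≤ LN) (hLN : LN ≤ CN * logR) (hLI0 : 0 ≤ LI) (hLI : LI ≤ LN ^ 3)
    (hc₂ : 0 ≤ c₂) (hN : 0 ≤ N)
    (hR2le : R ^ 2 ≤ c₂ * N ^ ((n : ℝ) - 1 / 2)) (hQ0 : 0 ≤ Q) (hQ : Q ≤ c₂ * N ^ ((n : ℝ) - 1 / 2)) :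
    |Cu| * (ymax * L ^ (2 * k)) ^ 2 * (R ^ 2 * LN ^ (2 * k) + Q * LI ^ k) ≤
      |Cu| * ymax ^ 2 * (3 * cK * CA) ^ (4 * k) * c₂ * ((CN * CA) ^ (2 * k) + (CN * CA) ^ (3 * k)) *
        logN ^ (7 * k) * N ^ ((n : ℝ) - 1 / 2) := by
  have hLle : L ≤ 3 * cK * CA * logN := by
    calc L ≤ 3 * cK * logR := hL
      _ ≤ 3 * cK * (CA * logN) := mul_le_mul_of_nonneg_left hlogRN (by positivity)
      _ = _ := by ring
  have hLNle : LN ≤ CN * CA * logN := by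
    calc LN ≤ CN * logR := hLN
      _ ≤ CN * (CA * logN) := mul_le_mul_of_nonneg_left hlogRN hCN
      _ = _ := by ring
  have hLIle : LI ≤ (CN * CA * logN) ^ 3 := hLI.trans (pow_le_pow_left₀ hLN0 hLNle 3)
  have hL4 : (ymax * L ^ (2 * k)) ^ 2 ≤ ymax ^ 2 * ((3 * cK * CA) ^ (4 * k) * logN ^ (4 * k)) := by
    have h1 : L ^ (2 * k) ≤ (3 * cK * CA * logN) ^ (2 * k) := pow_le_pow_left₀ hL0 hLle _
    have h2 : (L ^ (2 * k)) ^ 2 ≤ ((3 * cK * CA * logN) ^ (2 * k)) ^ 2 := pow_le_pow_left₀ (by positivity) h1 2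
    calc (ymax * L ^ (2 * k)) ^ 2 = ymax ^ 2 * (L ^ (2 * k)) ^ 2 := by ring
      _ ≤ ymax ^ 2 * ((3 * cK * CA * logN) ^ (2 * k)) ^ 2 := mul_le_mul_of_nonneg_left h2 (by positivity)
      _ = ymax ^ 2 * ((3 * cK * CA) ^ (4 * k) * logN ^ (4 * k)) := by ring
  have hLN2 : LN ^ (2 * k) ≤ (CN * CA) ^ (2 * k) * logN ^ (2 * k) := by
    rw [← mul_pow]; exact pow_le_pow_left₀ hLN0 hLNle _
  have hLI3 : LI ^ k ≤ (CN * CA) ^ (3 * k) * logN ^ (3 * k) := by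
    calc LI ^ k ≤ ((CN * CA * logN) ^ 3) ^ k := pow_le_pow_left₀ hLI0 hLIle _
      _ = (CN * CA) ^ (3 * k) * logN ^ (3 * k) := by ring
  have hlog23 : logN ^ (2 * k) ≤ logN ^ (3 * k) := pow_le_pow_right₀ hlogN (by omega)
  have hbr : R ^ 2 * LN ^ (2 * k) + Q * LI ^ k ≤
      c₂ * N ^ ((n : ℝ) - 1 / 2) * (((CN * CA) ^ (2 * k) + (CN * CA) ^ (3 * k)) * logN ^ (3 * k)) := by
    have hX0 : 0 ≤ c₂ * N ^ ((n : ℝ) - 1 / 2) := by positivity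
    have h1 : R ^ 2 * LN ^ (2 * k) ≤ c₂ * N ^ ((n : ℝ) - 1 / 2) * ((CN * CA) ^ (2 * k) * logN ^ (3 * k)) := by
      have h1' : LN ^ (2 * k) ≤ (CN * CA) ^ (2 * k) * logN ^ (3 * k) :=
        hLN2.trans (mul_le_mul_of_nonneg_left hlog23 (by positivity))
      exact mul_le_mul hR2le h1' (by positivity) hX0
    have h2 : Q * LI ^ k ≤ c₂ * N ^ ((n : ℝ) - 1 / 2) * ((CN * CA) ^ (3 * k) * logN ^ (3 * k)) :=
      mul_le_mul hQ hLI3 (by positivity) hX0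
    calc _ ≤ _ := add_le_add h1 h2
      _ = _ := by ring
  calc _ ≤ |Cu| * (ymax ^ 2 * ((3 * cK * CA) ^ (4 * k) * logN ^ (4 * k))) *
        (c₂ * N ^ ((n : ℝ) - 1 / 2) * (((CN * CA) ^ (2 * k) + (CN * CA) ^ (3 * k)) * logN ^ (3 * k))) :=
        mul_le_mul (mul_le_mul_of_nonneg_left hL4 (abs_nonneg _)) hbr (by positivity) (by positivity)
    _ = _ := by ring

/-- Bookkeeping for the second error term of Lemma 2.2, (iii): the main term from below,
`N^d ≤ (A/w)(c_K d log R)^k · (log N)^{k+1} (C_φ/c_K)^k/c₁`. [folklore] -/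
theorem term2_main_lower {k n : ℕ} {N A w logR logN cK Cφ lD d c₁ : ℝ}
    (hN : 1 ≤ N) (hlogN : 1 ≤ logN) (hc₁ : 0 < c₁) (hA₁ : c₁ * N ^ n ≤ A) (hlogR1 : 1 ≤ logR)
    (hcK : 0 < cK) (hw1 : 1 ≤ w) (hw : w ≤ logN) (hCφ : 0 < Cφ) (hlD0 : 0 < lD) (hlD : lD ≤ logN)
    (hd : 1 / (Cφ * lD) ≤ d) :
    N ^ n ≤ (A / w * (cK * d * logR) ^ k) * (logN ^ (k + 1) * (Cφ / cK) ^ k / c₁) := by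
  have hNpos : 0 < N := by linarith
  have hApos : 0 < A := lt_of_lt_of_le (by positivity) hA₁
  have hlogN0 : 0 < logN := by linarith
  have hd0 : 0 < d := lt_of_lt_of_le (by positivity) hd
  have hP0 : cK / (Cφ * logN) ≤ cK * d * logR := by
    have h1 : 1 / (Cφ * logN) ≤ d := by
      refine le_trans ?_ hd
      exact one_div_le_one_div_of_le (by positivity) (mul_le_mul_of_nonneg_left hlD hCφ.le)
    calc cK / (Cφ * logN) = cK * (1 / (Cφ * logN)) * 1 := by ring
      _ ≤ cK * d * logR := mul_le_mul (mul_le_mul_of_nonneg_left h1 hcK.le) hlogR1 zero_le_one (by positivity)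
  have hP0pos : 0 < cK / (Cφ * logN) := by positivity
  have hMlow : c₁ * N ^ n / logN * (cK / (Cφ * logN)) ^ k ≤ A / w * (cK * d * logR) ^ k := by
    refine mul_le_mul ?_ (pow_le_pow_left₀ hP0pos.le hP0 k) (by positivity) (by positivity)
    rw [div_le_div_iff₀ hlogN0 (by positivity)]
    calc c₁ * N ^ n * w ≤ A * w := mul_le_mul_of_nonneg_right hA₁ (by positivity)
      _ ≤ A * logN := mul_le_mul_of_nonneg_left hw hApos.le
  have heq : (N : ℝ) ^ n = (c₁ * N ^ n / logN * (cK / (Cφ * logN)) ^ k) *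
      (logN ^ (k + 1) * (Cφ / cK) ^ k / c₁) := by
    rw [div_pow, div_pow, mul_pow, pow_succ]
    field_simp
  rw [heq]
  exact mul_le_mul_of_nonneg_right hMlow (by positivity)

/-- **Bookkeeping for the second error term of Lemma 2.2**: the error
`|C_u| (y_max L^{2k})² (R² L_N^{2k} + (N^d/N𝔴)^{1−1/d} R^{2/d} L_∩^k)` of `abs_S1_sub_main_le` is at most
`CONST · (log N)^{8k+1} N^{-1/2}` times the main term `(A/N𝔴)(c_K (φ(𝔴)/N𝔴) log R)^k`, given the
polylogarithmic bounds on `L, L_N, L_∩, N𝔴, log D₀` and `c₁ N^d ≤ A ≤ c₂ N^d`.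
[cite: CastilloEtAl2015, proof of Lemma 2.2 (the error R²(log R)^{O(k)} + |A|^{1−1/d}…)] -/
theorem term2_le {k n : ℕ} {N A w R logR logN L LN LI Cu ymax cK Cφ lD d c₁ c₂ CN CA η₀ : ℝ}
    (hn : 1 ≤ n) (hN : 1 ≤ N) (hlogN : 1 ≤ logN)
    (hc₁ : 0 < c₁) (hA₁ : c₁ * N ^ n ≤ A) (hc₂ : 1 ≤ c₂) (hA₂ : A ≤ c₂ * N ^ n) (hA1 : 1 ≤ A)
    (hη2 : 2 * η₀ ≤ 1 / 2) (hR : R = A ^ η₀)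
    (hlogR1 : 1 ≤ logR) (hlogRN : logR ≤ CA * logN)
    (hcK : 0 < cK) (hL0 : 0 ≤ L) (hL : L ≤ 3 * cK * logR)
    (hCN : 0 ≤ CN) (hLN0 : 0 ≤ LN) (hLN : LN ≤ CN * logR) (hLI0 : 0 ≤ LI) (hLI : LI ≤ LN ^ 3)
    (hw1 : 1 ≤ w) (hw : w ≤ logN)
    (hCφ : 0 < Cφ) (hlD0 : 0 < lD) (hlD : lD ≤ logN) (hd : 1 / (Cφ * lD) ≤ d) :
    |Cu| * ((ymax * L ^ (2 * k)) ^ 2 *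
        (R ^ 2 * LN ^ (2 * k) + (N ^ n / w) ^ (1 - 1 / (n : ℝ)) * (R ^ 2) ^ (1 / (n : ℝ)) * LI ^ k)) ≤
      (|Cu| * ymax ^ 2 * (3 * cK * CA) ^ (4 * k) * c₂ * ((CN * CA) ^ (2 * k) + (CN * CA) ^ (3 * k)) *
          ((Cφ / cK) ^ k / c₁) * logN ^ (8 * k + 1) * N ^ (-(1 : ℝ) / 2)) *
        (A / w * (cK * d * logR) ^ k) := by
  rw [← mul_assoc]
  have hNpos : 0 < N := by linarith
  have hNn : (N : ℝ) ^ n = N ^ (n : ℝ) := (Real.rpow_natCast N n).symm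
  obtain ⟨hR2le, hpow2⟩ := term2_pow_bounds hn hN hc₂ hA₂ hA1 hη2 hR hw1
  have hQ0 : 0 ≤ (N ^ n / w) ^ (1 - 1 / (n : ℝ)) * (R ^ 2) ^ (1 / (n : ℝ)) := by positivity
  have hCA0 : 0 ≤ CA := by
    have : (1 : ℝ) ≤ CA * logN := hlogR1.trans hlogRN
    nlinarith
  have hE2 := term2_log_bounds (k := k) (Cu := Cu) (ymax := ymax) hlogN hCA0 hlogRN hcK hL0 hL hCN hLN0 hLN
    hLI0 hLI (by linarith) hNpos.le hR2le hQ0 hpow2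
  have hNn_le := term2_main_lower (k := k) hN hlogN hc₁ hA₁ hlogR1 hcK hw1 hw hCφ hlD0 hlD hd
  have hsplit : N ^ ((n : ℝ) - 1 / 2) = N ^ (-(1 : ℝ) / 2) * N ^ n := by
    rw [hNn, ← Real.rpow_add hNpos]; ring_nf
  obtain ⟨K₁, hK₁⟩ : ∃ x : ℝ, x = |Cu| * ymax ^ 2 * (3 * cK * CA) ^ (4 * k) * c₂ *
      ((CN * CA) ^ (2 * k) + (CN * CA) ^ (3 * k)) := ⟨_, rfl⟩
  have hK₁0 : 0 ≤ K₁ := by rw [hK₁]; positivity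
  rw [← hK₁] at hE2 ⊢
  have hmid : K₁ * logN ^ (7 * k) * N ^ ((n : ℝ) - 1 / 2) ≤
      K₁ * logN ^ (7 * k) * N ^ (-(1 : ℝ) / 2) *
        ((A / w * (cK * d * logR) ^ k) * (logN ^ (k + 1) * (Cφ / cK) ^ k / c₁)) := by
    rw [hsplit, ← mul_assoc]
    exact mul_le_mul_of_nonneg_left hNn_le (by positivity)
  have hmul : (R ^ 2 * LN ^ (2 * k) + (N ^ n / w) ^ (1 - 1 / (n : ℝ)) * (R ^ 2) ^ (1 / (n : ℝ)) * LI ^ k) =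
      (R ^ 2 * LN ^ (2 * k) + ((N ^ n / w) ^ (1 - 1 / (n : ℝ)) * (R ^ 2) ^ (1 / (n : ℝ))) * LI ^ k) := by
    ring
  rw [hmul]
  refine hE2.trans (hmid.trans (le_of_eq ?_))
  have e : logN ^ (8 * k + 1) = logN ^ (7 * k) * logN ^ (k + 1) := by rw [← pow_add]; ring_nf
  rw [e]; ring


/-! ### More facts along `N`: `|A(N)|`, `R`, the junk factor, `L ≤ 3P` -/

variable (K) in
/-- The density `ℓ_K = (1 − 2^{−d})/√|D_K|` with `|A(N)| ∼ ℓ_K (2N)^d`. [cite: CastilloEtAl2015, proof of Corollary 2.6] -/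
def boxDensity : ℝ := (1 - 2⁻¹ ^ finrank ℚ K) / √|(discr K : ℝ)|

/-- `ℓ_K > 0`. [folklore] -/
theorem boxDensity_pos : 0 < boxDensity K := by
  have hD : 0 < √|(discr K : ℝ)| := Real.sqrt_pos.2 (abs_pos.2 (Int.cast_ne_zero.2 (discr_ne_zero K)))
  have h2d : (0 : ℝ) < 1 - 2⁻¹ ^ finrank ℚ K := by
    rw [sub_pos]; exact pow_lt_one₀ (by norm_num) (by norm_num) finrank_pos.ne'
  unfold boxDensity
  positivity

/-- The main term of the lattice-point count is `ℓ_K (2N)^d`: `(2^d − 1) N^d/√|D_K| = ℓ_K (2N)^d`. [folklore] -/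
theorem X_numerator_eq (N : ℝ) :
    (2 ^ finrank ℚ K - 1) * N ^ finrank ℚ K / √|(discr K : ℝ)| = boxDensity K * (2 * N) ^ finrank ℚ K := by
  unfold boxDensity
  rw [mul_pow, inv_pow]
  have h2 : (2 : ℝ) ^ finrank ℚ K ≠ 0 := by positivity
  field_simp

/-- `(ℓ_K (2N)^d − |A(N)|)/|A(N)| → 0`. [cite: CastilloEtAl2015, proof of Corollary 2.6 (|A(N)| ∼ …)] -/
theorem tendsto_boxDensity_ratio [IsTotallyReal K] :
    Tendsto (fun N : ℝ => (boxDensity K * (2 * N) ^ finrank ℚ K - cardA K N) / cardA K N) atTop (𝓝 0) := by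
  have h := tendsto_cardA_div (K := K)
  have hℓ := boxDensity_pos (K := K)
  have h1 : Tendsto (fun N : ℝ => boxDensity K / ((cardA K N : ℝ) / (2 * N) ^ finrank ℚ K) - 1) atTop
      (𝓝 (boxDensity K / boxDensity K - 1)) :=
    (tendsto_const_nhds.div h hℓ.ne').sub_const 1
  rw [div_self hℓ.ne', sub_self] at h1
  refine h1.congr' ?_
  filter_upwards [(tendsto_cardA_atTop (K := K)).eventually_gt_atTop 0, eventually_gt_atTop (0 : ℝ)]
    with N hA hN
  have h2N : (0 : ℝ) < (2 * N) ^ finrank ℚ K := by positivity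
  field_simp

/-- `(ℓ_K/2)(2N)^d ≤ |A(N)| ≤ 2ℓ_K (2N)^d` eventually. [cite: CastilloEtAl2015, proof of Corollary 2.6] -/
theorem eventually_cardA_bounds [IsTotallyReal K] :
    ∀ᶠ N : ℝ in atTop, boxDensity K / 2 * (2 * N) ^ finrank ℚ K ≤ cardA K N ∧
      (cardA K N : ℝ) ≤ 2 * boxDensity K * (2 * N) ^ finrank ℚ K := by
  have h := tendsto_cardA_div (K := K)
  have hℓ := boxDensity_pos (K := K)
  have h1 : ∀ᶠ N : ℝ in atTop, boxDensity K / 2 ≤ (cardA K N : ℝ) / (2 * N) ^ finrank ℚ K :=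
    h.eventually (eventually_ge_nhds (by unfold boxDensity at hℓ ⊢; linarith))
  have h2 : ∀ᶠ N : ℝ in atTop, (cardA K N : ℝ) / (2 * N) ^ finrank ℚ K ≤ 2 * boxDensity K :=
    h.eventually (eventually_le_nhds (by unfold boxDensity at hℓ ⊢; linarith))
  filter_upwards [h1, h2, eventually_gt_atTop (0 : ℝ)] with N h1 h2 hN
  have h2N : (0 : ℝ) < (2 * N) ^ finrank ℚ K := by positivity
  rw [le_div_iff₀ h2N] at h1
  rw [div_le_iff₀ h2N] at h2
  exact ⟨h1, h2⟩

/-- `R(N) = |A(N)|^{θ/2−δ} → ∞`. [folklore] -/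
theorem tendsto_nfR_atTop [IsTotallyReal K] {θ δ : ℝ} (hη : 0 < θ / 2 - δ) :
    Tendsto (nfR K θ δ) atTop atTop :=
  (tendsto_rpow_atTop hη).comp tendsto_cardA_atTop

/-- `𝔐 = (|A(N)|/N𝔴)(c_K (φ(𝔴)/N𝔴) log R)^k`. [folklore] -/
theorem nfMainTerm_eq (k : ℕ) (θ δ N : ℝ) :
    nfMainTerm K k θ δ N = (cardA K N : ℝ) / Ideal.absNorm (paramW K N) *
      (dedekindZeta_residue K * (idealTotient K (paramW K N) / (Ideal.absNorm (paramW K N) : ℝ)) *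
        Real.log (nfR K θ δ N)) ^ k := by
  have hw : (0 : ℝ) < Ideal.absNorm (paramW K N) := by
    exact_mod_cast Nat.pos_of_ne_zero (by rw [Ne, Ideal.absNorm_eq_zero_iff]; exact paramW_ne_bot N)
  unfold nfMainTerm
  simp only [mul_pow, div_pow]
  field_simp
  ring

/-- **The junk factor of Lemma 2.2**: `Z^m − 1 ≤ C_Z D₀^{-1/2}` eventually, where
`Z = ∑_{𝔞 ∈ G1} 1/φ(𝔞)²` (`Z − 1 ≪ D₀^{-1/2}` by `IdealSieve.sum_inv_prod_sub_sq_le`, and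
`Z^m − 1 ≤ m (Z − 1) Z^{m−1}`). [cite: CastilloEtAl2015, proof of Lemma 2.2] -/
theorem eventually_sqSum_pow_sub_one_le [IsTotallyReal K] (m : ℕ) {θ δ : ℝ} (hη : 0 < θ / 2 - δ) :
    ∃ CZ : ℝ, 0 ≤ CZ ∧ ∀ᶠ N : ℝ in atTop,
      0 ≤ (∑ 𝔞 ∈ G1 K (paramW K N) (nfR K θ δ N), 1 / idealTotient K 𝔞 ^ 2) ^ m - 1 ∧
      (∑ 𝔞 ∈ G1 K (paramW K N) (nfR K θ δ N), 1 / idealTotient K 𝔞 ^ 2) ^ m - 1 ≤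
        CZ * paramD0 N ^ (-(1 : ℝ) / 2) := by
  obtain ⟨Z, hZ0, hZ⟩ := sum_inv_prod_sub_sq_le (K := K)
  refine ⟨m * 2 ^ (m - 1) * (4 * Z * Real.exp (4 * Z)), by positivity, ?_⟩
  have hτ : Tendsto (fun N : ℝ => 4 * Z * Real.exp (4 * Z) * paramD0 N ^ (-(1 : ℝ) / 2)) atTop (𝓝 0) := by
    have h1 : Tendsto (fun N : ℝ => 4 * Z * Real.exp (4 * Z) * paramD0 N ^ (-(1 / 2 : ℝ))) atTop
        (𝓝 (4 * Z * Real.exp (4 * Z) * 0)) :=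
      ((tendsto_rpow_neg_atTop (by norm_num : (0 : ℝ) < 1 / 2)).comp tendsto_paramD0_atTop).const_mul _
    rw [mul_zero] at h1
    refine h1.congr' (Eventually.of_forall fun N => ?_)
    norm_num
  filter_upwards [hτ.eventually (eventually_le_nhds one_pos), tendsto_paramD0_atTop.eventually_ge_atTop 1,
    (tendsto_nfR_atTop (K := K) hη).eventually_ge_atTop 1] with N hτ1 hD1 hR1
  obtain ⟨L₂, hL₂⟩ : ∃ x : ℝ, x = ∑ 𝔞 ∈ G1 K (paramW K N) (nfR K θ δ N), 1 / idealTotient K 𝔞 ^ 2 :=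
    ⟨_, rfl⟩
  rw [← hL₂]
  have h1 := sum_G1_inv_idealTotient_sq_sub_one_eq (paramW K N) hR1 (K := K)
  rw [← hL₂] at h1
  have h2 := hZ 1 (paramW K N) (paramW_ne_bot N) (paramD0 N) hD1 (by exact_mod_cast hD1)
    (fun P hP hle => dvd_paramW_of_prime_of_absNorm_le hP hle) (nfR K θ δ N)
  have hτle : L₂ - 1 ≤ 4 * Z * Real.exp (4 * Z) * paramD0 N ^ (-(1 : ℝ) / 2) := by
    rw [h1]
    refine h2.trans (le_of_eq ?_)
    norm_num
  have hL₂1 : 1 ≤ L₂ := by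
    have htop : (⊤ : Ideal (𝓞 K)) ∈ G1 K (paramW K N) (nfR K θ δ N) := top_mem_G1 hR1
    have := Finset.single_le_sum (f := fun 𝔞 : Ideal (𝓞 K) => 1 / idealTotient K 𝔞 ^ 2)
      (fun 𝔞 ha => by positivity) htop
    rw [idealTotient_top, one_pow, div_one] at this
    rw [hL₂]; exact this
  have hτ0 : 0 ≤ 4 * Z * Real.exp (4 * Z) * paramD0 N ^ (-(1 : ℝ) / 2) := by positivity
  have hL₂2 : L₂ ≤ 2 := by linarith
  constructor
  · linarith [one_le_pow₀ (M₀ := ℝ) hL₂1 (n := m)]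
  · calc L₂ ^ m - 1 ≤ m * (L₂ - 1) * L₂ ^ (m - 1) := SquarefreeSums.pow_sub_one_le hL₂1 m
      _ ≤ m * (4 * Z * Real.exp (4 * Z) * paramD0 N ^ (-(1 : ℝ) / 2)) * 2 ^ (m - 1) := by
          refine mul_le_mul (mul_le_mul_of_nonneg_left hτle (Nat.cast_nonneg m))
            (pow_le_pow_left₀ (by linarith) hL₂2 _) (by positivity) (by positivity)
      _ = _ := by ring

/-- **`L ≤ 3 c_K (φ(𝔴)/N𝔴) log R` eventually** along `𝔴(N), R(N)`. [cite: CastilloEtAl2015, proof of Proposition 2.1] -/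
theorem eventually_sum_G1_le_three [IsTotallyReal K] {θ δ : ℝ} (hη : 0 < θ / 2 - δ) :
    ∀ᶠ N : ℝ in atTop, ∑ 𝔞 ∈ G1 K (paramW K N) (nfR K θ δ N), 1 / idealTotient K 𝔞 ≤
      3 * (dedekindZeta_residue K * (idealTotient K (paramW K N) / (Ideal.absNorm (paramW K N) : ℝ)) *
        Real.log (nfR K θ δ N)) := by
  obtain ⟨C, Z, hC0, hZ0, hsharp⟩ := abs_sum_inv_totientIdeal_sub_sharp (K := K)
  obtain ⟨Kc, hKc⟩ : ∃ x : ℝ, x = Real.exp (5 * Z) *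
      (max C (dedekindZeta_residue K) + 4 * dedekindZeta_residue K) := ⟨_, rfl⟩
  have hev1 : ∀ᶠ N : ℝ in atTop, Real.exp (5 * Z) * (paramD0 N ^ (-(1 : ℝ) / 4) /
      ∑ 𝔢 ∈ idealDivisors K (paramW K N), (idealMoebius 𝔢 : ℝ) / Ideal.absNorm 𝔢) ≤ 1 := by
    have h1 := (tendsto_eps_param (K := K)).const_mul (Real.exp (5 * Z))
    rw [mul_zero] at h1
    exact h1.eventually (eventually_le_nhds one_pos)
  have hev2 : ∀ᶠ N : ℝ in atTop, Kc / dedekindZeta_residue K *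
      ((1 + ∑ 𝔢 ∈ idealDivisors K (paramW K N), (1 + Real.log (Ideal.absNorm 𝔢)) / Ideal.absNorm 𝔢) /
        ((∑ 𝔢 ∈ idealDivisors K (paramW K N), (idealMoebius 𝔢 : ℝ) / Ideal.absNorm 𝔢) *
          Real.log (nfR K θ δ N))) ≤ 1 := by
    have h1 := (tendsto_E_param (K := K) hη).const_mul (Kc / dedekindZeta_residue K)
    rw [mul_zero] at h1
    exact h1.eventually (eventually_le_nhds one_pos)
  filter_upwards [hev1, hev2, tendsto_paramD0_atTop.eventually_ge_atTop 1,
    (tendsto_nfR_atTop (K := K) hη).eventually_gt_atTop 1] with N h1 h2 hD1 hR1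
  have h := sum_G1_inv_idealTotient_le_three_mul hC0 hsharp (paramW_ne_bot N) hD1
    (fun P hP hle => dvd_paramW_of_prime_of_absNorm_le hP hle) hR1 le_rfl hKc h1 h2
  rwa [dsum_paramW_eq] at h

/-! ### Lemma 2.2 in `o`-form and Proposition 2.1 (`S₁`) -/

/-- The shift hypothesis of Lemma 2.2 holds eventually: the primes dividing some `hᵢ − hⱼ` (`i ≠ j`)
divide `𝔴(N)` for all large `N`. [cite: CastilloEtAl2015, §2.2] -/
theorem eventually_shift_dvd_paramW {h : Fin k → 𝓞 K} (hinj : Function.Injective h) :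
    ∀ᶠ N : ℝ in atTop, ∀ i j, i ≠ j → ∀ P : Ideal (𝓞 K), P.IsPrime → h i - h j ∈ P → P ∣ paramW K N := by
  have hp : ∀ p : {p : Fin k × Fin k // p.1 ≠ p.2}, ∀ᶠ N : ℝ in atTop,
      ∀ P : Ideal (𝓞 K), P.IsPrime → h p.1.1 - h p.1.2 ∈ P → P ∣ paramW K N :=
    fun p => eventually_dvd_paramW_of_mem (sub_ne_zero.2 (hinj.ne p.2))
  filter_upwards [Filter.eventually_all.2 hp] with N hN i j hij P hP hmem
  exact hN ⟨(i, j), hij⟩ P hP hmem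

/-- `(log N)^m N^{-1/2} → 0`. [folklore] -/
theorem tendsto_log_pow_mul_rpow_neg_half (m : ℕ) :
    Tendsto (fun N : ℝ => Real.log N ^ m * N ^ (-(1 : ℝ) / 2)) atTop (𝓝 0) := by
  have h := (isLittleO_log_rpow_rpow_atTop ((m : ℕ) : ℝ) (by norm_num : (0 : ℝ) < 1 / 2)).tendsto_div_nhds_zero
  refine h.congr' ?_
  filter_upwards [eventually_gt_atTop (0 : ℝ)] with N hN
  rw [Real.rpow_natCast, div_eq_mul_inv, ← Real.rpow_neg hN.le]
  norm_num

/-- **Lemma 2.2 (Castillo et al.), with all error terms made `o(𝔐)`**: for the data of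
Proposition 2.1 (`𝔴 = 𝔴(N)`, `R = |A(N)|^{θ/2−δ}`, `y = smoothY`, distinct shifts, any classes
`v₀(N)`), eventually
`|S₁ − X ∑_𝔲 y_𝔲²/∏φ(𝔲ᵢ)| ≤ g(N) 𝔐(N)` with `g → 0`, where `X = (2^d − 1)N^d/(N𝔴 √|D_K|)` is the
main term of the lattice-point count (`abs_S1_sub_main_le` + `L ≤ 3P`, the junk factor
`Z^{k²−k} − 1 ≪ D₀^{-1/2}`, and `R²(log R)^{O(k)} + |A|^{1−1/d}R^{2/d}(log R)^{O(k)} ≪ (log N)^{8k+1} N^{-1/2} 𝔐`).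
[cite: CastilloEtAl2015, Lemma 2.2 and its proof] -/
theorem eventually_abs_S1_sub_le [IsTotallyReal K] {h : Fin k → 𝓞 K}
    (hinj : Function.Injective h) {θ δ : ℝ} (hδ : 0 < δ) (hη : 0 < θ / 2 - δ) (hθ : θ ≤ 1 / 2)
    {G : (Fin k → ℝ) → ℝ} (hG : Continuous G) (v₀ : ℝ → 𝓞 K) :
    ∃ g : ℝ → ℝ, Tendsto g atTop (𝓝 0) ∧ ∀ᶠ N : ℝ in atTop,
      |sieveS1 K k h θ δ G v₀ N -
          (2 ^ finrank ℚ K - 1) * N ^ finrank ℚ K /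
              (Ideal.absNorm (paramW K N) * √|(discr K : ℝ)|) *
            ∑ 𝔲 ∈ boxG K k (paramW K N) (nfR K θ δ N),
              smoothY K k G (nfR K θ δ N) (paramW K N) 𝔲 ^ 2 / ∏ i, idealTotient K (𝔲 i)| ≤
        g N * nfMainTerm K k θ δ N := by
  classical
  -- constants
  obtain ⟨Gmax, hG0, hGmax⟩ : ∃ M : ℝ, 0 ≤ M ∧ ∀ x ∈ maynardSimplex k, |G x| ≤ M := by
    obtain ⟨M, hM⟩ := (isCompact_maynardSimplex k).exists_bound_of_continuousOn hG.continuousOn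
    exact ⟨max M 0, le_max_right _ _, fun x hx => (hM x hx).trans (le_max_left _ _)⟩
  obtain ⟨Cu, hCu⟩ := exists_uniformCount (K := K)
  obtain ⟨CN, hCN⟩ := sum_G1_inv_absNorm_le (K := K)
  obtain ⟨CZ, hCZ0, hCZ⟩ := eventually_sqSum_pow_sub_one_le (K := K) (Fintype.card (OffDiag k)) hη
  obtain ⟨Cφ, hCφ0, hCφ⟩ := one_div_le_idealTotient_paramW_div (K := K)
  obtain ⟨Cw, hCw0, hCw⟩ := log_absNorm_paramW_le (K := K)
  have hρ0 : 0 < dedekindZeta_residue K := dedekindZeta_residue_pos K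
  obtain ⟨n, hn⟩ : ∃ m : ℕ, m = finrank ℚ K := ⟨_, rfl⟩
  have hn1 : 1 ≤ n := by rw [hn]; exact finrank_pos
  have hℓ := boxDensity_pos (K := K)
  obtain ⟨c₁, hc₁⟩ : ∃ x : ℝ, x = boxDensity K / 2 * 2 ^ n := ⟨_, rfl⟩
  have hc₁0 : 0 < c₁ := by rw [hc₁]; positivity
  obtain ⟨c₂, hc₂⟩ : ∃ x : ℝ, x = max 1 (2 * boxDensity K * 2 ^ n) := ⟨_, rfl⟩
  have hc₂1 : 1 ≤ c₂ := by rw [hc₂]; exact le_max_left _ _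
  obtain ⟨CONST, hCONST⟩ : ∃ x : ℝ, x = |Cu| * Gmax ^ 2 * (3 * dedekindZeta_residue K * (n + 1)) ^ (4 * k) * c₂ *
      ((|CN| * (n + 1)) ^ (2 * k) + (|CN| * (n + 1)) ^ (3 * k)) *
        ((Cφ / dedekindZeta_residue K) ^ k / c₁) := ⟨_, rfl⟩
  -- the function `g`
  refine ⟨fun N => 2 * 3 ^ k * Gmax ^ 2 * CZ * paramD0 N ^ (-(1 : ℝ) / 2) +
    CONST * (Real.log N ^ (8 * k + 1) * N ^ (-(1 : ℝ) / 2)), ?_, ?_⟩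
  · have h1 : Tendsto (fun N : ℝ => 2 * 3 ^ k * Gmax ^ 2 * CZ * paramD0 N ^ (-(1 / 2 : ℝ))) atTop
        (𝓝 (2 * 3 ^ k * Gmax ^ 2 * CZ * 0)) :=
      ((tendsto_rpow_neg_atTop (by norm_num : (0 : ℝ) < 1 / 2)).comp tendsto_paramD0_atTop).const_mul _
    have h2 := (tendsto_log_pow_mul_rpow_neg_half (8 * k + 1)).const_mul CONST
    rw [mul_zero] at h1 h2
    have h3 := h1.add h2
    rw [add_zero] at h3
    refine h3.congr' (Eventually.of_forall fun N => ?_)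
    norm_num
  -- the eventual facts
  have hA := tendsto_cardA_atTop (K := K)
  have hRt := tendsto_nfR_atTop (K := K) hη
  filter_upwards [eventually_ge_atTop (1 : ℝ), (Real.tendsto_log_atTop).eventually_ge_atTop 1,
    (Real.tendsto_log_atTop).eventually_ge_atTop (Real.log c₂),
    tendsto_paramD0_atTop.eventually_ge_atTop 2, eventually_cardA_bounds (K := K),
    hA.eventually_ge_atTop 1, hRt.eventually_ge_atTop 2, hRt.eventually_ge_atTop (Real.exp 1),
    eventually_shift_dvd_paramW (K := K) hinj, eventually_sum_G1_le_three (K := K) hη, hCZ,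
    eventually_exp_mul_paramD0_le Cw one_pos, eventually_exp_mul_paramD0_le 1 one_pos]
    with N hN1 hlogN hlogc₂ hD2 hAb hA1 hR2 hRe hh hL3 hτ hexpw hexp1
  rw [← hn] at hAb
  -- notation and basic facts at `N`
  obtain ⟨w, hw⟩ : ∃ x : ℝ, x = (Ideal.absNorm (paramW K N) : ℝ) := ⟨_, rfl⟩
  have hw1 : 1 ≤ w := by
    rw [hw]; exact_mod_cast Nat.one_le_iff_ne_zero.2 (by
      rw [Ne, Ideal.absNorm_eq_zero_iff]; exact paramW_ne_bot N)
  have hw0 : 0 < w := by linarith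
  obtain ⟨R, hR⟩ : ∃ x : ℝ, x = nfR K θ δ N := ⟨_, rfl⟩
  rw [← hR] at hR2 hRe hL3 hτ
  have hR1 : 1 < R := by linarith
  have hRpos : 0 < R := by linarith
  have hlogR1 : 1 ≤ Real.log R := by
    rw [Real.le_log_iff_exp_le hRpos]; exact hRe
  obtain ⟨A, hAdef⟩ : ∃ x : ℝ, x = (cardA K N : ℝ) := ⟨_, rfl⟩
  rw [← hAdef] at hAb hA1
  have hApos : 0 < A := by linarith
  have hNpos : 0 < N := by linarith
  obtain ⟨dN, hdN⟩ : ∃ x : ℝ, x = idealTotient K (paramW K N) / (Ideal.absNorm (paramW K N) : ℝ) := ⟨_, rfl⟩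
  rw [← hdN] at hL3
  have hd1 : dN ≤ 1 := by rw [hdN]; exact idealTotient_div_absNorm_le_one (paramW_ne_bot N)
  have hdφ : 1 / (Cφ * Real.log (paramD0 N)) ≤ dN := by rw [hdN]; exact hCφ N hD2
  have hlD0 : 0 < Real.log (paramD0 N) := Real.log_pos (by linarith)
  have hd0 : 0 < dN := lt_of_lt_of_le (by positivity) hdφ
  obtain ⟨P, hP⟩ : ∃ x : ℝ, x = dedekindZeta_residue K * dN * Real.log R := ⟨_, rfl⟩
  have hP0 : 0 < P := by rw [hP]; positivity
  rw [← hP] at hL3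
  -- the main term
  have hMT : nfMainTerm K k θ δ N = A / w * P ^ k := by
    rw [nfMainTerm_eq, ← hdN, ← hAdef, ← hw, ← hR, ← hP]
  -- Lemma 2.2 (combinatorial form)
  have hyR : ∀ 𝔯, smoothY K k G R (paramW K N) 𝔯 ≠ 0 → ∏ i, (Ideal.absNorm (𝔯 i) : ℝ) ≤ R :=
    fun 𝔯 h𝔯 => prod_absNorm_le_of_smoothY_ne_zero hR1 h𝔯
  have hmain := abs_S1_sub_main_le (k := k) hCu (paramW_ne_bot N) hR1.le hR1.le
    (supportedOn_smoothY k G R (paramW K N)) (abs_smoothY_le hGmax hG0 R (paramW K N)) hyR hh (v₀ N) hN1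
  rw [← hn, ← hw] at hmain
  obtain ⟨L, hLdef⟩ : ∃ x : ℝ, x = ∑ 𝔞 ∈ G1 K (paramW K N) R, 1 / idealTotient K 𝔞 := ⟨_, rfl⟩
  obtain ⟨L₂, hL₂def⟩ : ∃ x : ℝ, x = ∑ 𝔞 ∈ G1 K (paramW K N) R, 1 / idealTotient K 𝔞 ^ 2 := ⟨_, rfl⟩
  obtain ⟨LN, hLNdef⟩ : ∃ x : ℝ, x = ∑ 𝔞 ∈ G1 K (paramW K N) R, 1 / (Ideal.absNorm 𝔞 : ℝ) := ⟨_, rfl⟩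
  obtain ⟨LI, hLIdef⟩ : ∃ x : ℝ, x = ∑ 𝔞 ∈ G1 K (paramW K N) R, ∑ 𝔟 ∈ G1 K (paramW K N) R,
      1 / (Ideal.absNorm (𝔞 ⊓ 𝔟) : ℝ) := ⟨_, rfl⟩
  rw [← hLdef, ← hL₂def, ← hLNdef, ← hLIdef] at hmain
  rw [← hLdef] at hL3
  rw [← hL₂def] at hτ
  have hL0 : 0 ≤ L := by
    rw [hLdef]; exact Finset.sum_nonneg fun 𝔞 ha => (one_div_pos.2 (idealTotient_pos (mem_G1.1 ha).1.1)).le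
  have hLN0 : 0 ≤ LN := by rw [hLNdef]; exact Finset.sum_nonneg fun _ _ => by positivity
  have hLI0 : 0 ≤ LI := by
    rw [hLIdef]; exact Finset.sum_nonneg fun _ _ => Finset.sum_nonneg fun _ _ => by positivity
  have hLNle : LN ≤ |CN| * Real.log R := by
    rw [hLNdef]
    exact (hCN (paramW K N) R hR2).trans (mul_le_mul_of_nonneg_right (le_abs_self _) (by linarith))
  have hLIle : LI ≤ LN ^ 3 := by rw [hLIdef, hLNdef]; exact sum_G1_inv_absNorm_inf_le (paramW K N) R
  -- `X = ℓ (2N)^n / w ≤ 2A/w`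
  have hX : (2 ^ n - 1) * N ^ n / (w * √|(discr K : ℝ)|) = boxDensity K * (2 * N) ^ n / w := by
    have hD : 0 < √|(discr K : ℝ)| := Real.sqrt_pos.2 (abs_pos.2 (Int.cast_ne_zero.2 (discr_ne_zero K)))
    rw [hn, ← X_numerator_eq (K := K) N]
    field_simp
  have hXle : boxDensity K * (2 * N) ^ n / w ≤ 2 * A / w :=
    div_le_div_of_nonneg_right (by linarith [hAb.1]) hw0.le
  -- the first error term
  have hterm1 : boxDensity K * (2 * N) ^ n / w * (Gmax ^ 2 * L ^ k * (L₂ ^ Fintype.card (OffDiag k) - 1)) ≤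
      (2 * 3 ^ k * Gmax ^ 2 * CZ * paramD0 N ^ (-(1 : ℝ) / 2)) * (A / w * P ^ k) := by
    have hLk : L ^ k ≤ (3 * P) ^ k := pow_le_pow_left₀ hL0 hL3 k
    have h1 : Gmax ^ 2 * L ^ k * (L₂ ^ Fintype.card (OffDiag k) - 1) ≤
        Gmax ^ 2 * (3 * P) ^ k * (CZ * paramD0 N ^ (-(1 : ℝ) / 2)) :=
      mul_le_mul (mul_le_mul_of_nonneg_left hLk (by positivity)) hτ.2 hτ.1 (by positivity)
    calc _ ≤ 2 * A / w * (Gmax ^ 2 * (3 * P) ^ k * (CZ * paramD0 N ^ (-(1 : ℝ) / 2))) :=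
          mul_le_mul hXle h1 (by
            have := hτ.1
            positivity) (by positivity)
      _ = _ := by rw [mul_pow]; ring
  -- the second error term
  have hη2 : 2 * (θ / 2 - δ) ≤ 1 / 2 := by linarith
  have hA₁ : c₁ * N ^ n ≤ A := by
    have := hAb.1
    rw [mul_pow] at this
    rw [hc₁]; linarith
  have hA₂ : A ≤ c₂ * N ^ n := by
    have h1 := hAb.2
    rw [mul_pow] at h1
    calc A ≤ 2 * boxDensity K * (2 ^ n * N ^ n) := h1
      _ = (2 * boxDensity K * 2 ^ n) * N ^ n := by ring
      _ ≤ c₂ * N ^ n := mul_le_mul_of_nonneg_right (by rw [hc₂]; exact le_max_right _ _) (by positivity)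
  have hlogRN : Real.log R ≤ (n + 1) * Real.log N := by
    have hlogA : Real.log A ≤ Real.log c₂ + n * Real.log N := by
      have h1 : Real.log A ≤ Real.log (c₂ * N ^ n) := Real.log_le_log hApos hA₂
      rw [Real.log_mul (by positivity) (by positivity), Real.log_pow] at h1
      exact h1
    have hlogRA : Real.log R = (θ / 2 - δ) * Real.log A := by rw [hR, hAdef]; exact log_nfR θ δ (hAdef ▸ hApos)
    have hlogA0 : 0 ≤ Real.log A := Real.log_nonneg hA1
    have hη1 : θ / 2 - δ ≤ 1 := by linarith only [hη2]
    rw [hlogRA]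
    have h3 : (θ / 2 - δ) * Real.log A ≤ 1 * Real.log A := mul_le_mul_of_nonneg_right hη1 hlogA0
    have h4 : ((n : ℕ) : ℝ) * Real.log N + Real.log N = (n + 1) * Real.log N := by ring
    linarith only [h3, hlogA, hlogc₂, h4]
  have hwlog : w ≤ Real.log N := by
    have h1 : Real.log w ≤ Cw * paramD0 N := by rw [hw]; exact hCw N hD2
    have h2 : w ≤ Real.exp (Cw * paramD0 N) := by
      rw [← Real.exp_log hw0]; exact Real.exp_le_exp.2 h1
    rw [Real.rpow_one] at hexpw
    exact h2.trans hexpw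
  have hlDle : Real.log (paramD0 N) ≤ Real.log N := by
    have h1 : Real.log (paramD0 N) ≤ Real.exp (1 * paramD0 N) := by
      have h2 : Real.log (paramD0 N) ≤ paramD0 N := (Real.log_le_sub_one_of_pos (by linarith)).trans (by linarith)
      rw [one_mul]
      exact h2.trans (by linarith [Real.add_one_le_exp (paramD0 N)])
    rw [Real.rpow_one] at hexp1
    exact h1.trans hexp1
  have hLle : L ≤ 3 * dedekindZeta_residue K * Real.log R := by
    refine hL3.trans ?_
    rw [hP]
    have : dedekindZeta_residue K * dN * Real.log R ≤ dedekindZeta_residue K * 1 * Real.log R :=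
      mul_le_mul_of_nonneg_right (mul_le_mul_of_nonneg_left hd1 hρ0.le) (by linarith)
    linarith
  have hRA : R = A ^ (θ / 2 - δ) := by rw [hR, hAdef]; rfl
  have hterm2 := term2_le (k := k) (Cu := Cu) (ymax := Gmax) (R := R) hn1 hN1 hlogN hc₁0 hA₁ hc₂1 hA₂ hA1
    hη2 hRA hlogR1 hlogRN hρ0 hL0 hLle (abs_nonneg CN) hLN0 hLNle hLI0 hLIle hw1 hwlog
    hCφ0 hlD0 hlDle hdφ
  rw [← hCONST] at hterm2
  have hPeq : dedekindZeta_residue K * dN * Real.log R = P := hP.symm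
  rw [hPeq] at hterm2
  -- assemble
  simp only [sieveS1]
  rw [← hR, ← hn, ← hw, hMT, hX]
  rw [hX] at hmain
  refine hmain.trans ?_
  rw [add_mul]
  refine add_le_add hterm1 ?_
  calc _ ≤ _ := hterm2
    _ = _ := by ring

/-! ### The main term is eventually positive -/

/-- `𝔐(N) > 0` for large `N` (`φ(𝔴) > 0`, `|A(N)| → ∞`, `c_K > 0`, `log R = (θ/2 − δ) log|A(N)| > 0`).
[cite: CastilloEtAl2015, Proposition 2.1] -/
theorem eventually_nfMainTerm_pos [IsTotallyReal K] (k : ℕ) {θ δ : ℝ} (hη : 0 < θ / 2 - δ) :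
    ∀ᶠ N : ℝ in atTop, 0 < nfMainTerm K k θ δ N := by
  filter_upwards [(tendsto_cardA_atTop (K := K)).eventually_gt_atTop 1] with N hN
  have hA0 : 0 < (cardA K N : ℝ) := by linarith
  have hφ : 0 < idealTotient K (paramW K N) := idealTotient_pos (paramW_ne_bot N)
  have hc : 0 < dedekindZeta_residue K := dedekindZeta_residue_pos K
  have hlogR : 0 < Real.log (nfR K θ δ N) := by
    rw [log_nfR θ δ hA0]
    exact mul_pos hη (Real.log_pos hN)
  have hn : (0 : ℝ) < Ideal.absNorm (paramW K N) := by
    exact_mod_cast Nat.pos_of_ne_zero (by rw [Ne, Ideal.absNorm_eq_zero_iff]; exact paramW_ne_bot N)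
  unfold nfMainTerm
  positivity

/-- **Proposition 2.1, the `S₁` asymptotic, PROVED** (Castillo et al. = Lemma 2.2 + Maynard's
Lemma 6.2 over `𝓞_K`): for `k ≥ 1`, distinct shifts, `0 < δ`, `0 < θ/2 − δ`, `θ ≤ 1/2`, continuous `G`
and any classes `v₀(N)`,
`S₁ = (1 + o(1)) φ(𝔴)^k |A(N)| (c_K log R)^k I_k(F)/N𝔴^{k+1}`:
`S₁ − 𝔐 I = (S₁ − X Σ) + (X − |A|/N𝔴) Σ + (|A|/N𝔴)(Σ − P^k I)`, each `o(𝔐)` by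
`eventually_abs_S1_sub_le`, `|A(N)| ∼ ℓ_K (2N)^d` and `diag_isLittleO`.
[cite: CastilloEtAl2015, Proposition 2.1 (S₁) and Lemma 2.2] -/
theorem S1_asymptotic [IsTotallyReal K] (hk : 0 < k) {h : Fin k → 𝓞 K} (hinj : Function.Injective h)
    {θ δ : ℝ} (hδ : 0 < δ) (hη : 0 < θ / 2 - δ) (hθ : θ ≤ 1 / 2) {G : (Fin k → ℝ) → ℝ} (hG : Continuous G)
    (v₀ : ℝ → 𝓞 K) : S1Asymptotic K k h θ δ G v₀ := by
  classical
  -- notation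
  obtain ⟨I, hI⟩ : ∃ x : ℝ, x = maynardI k ((maynardSimplex k).indicator G) := ⟨_, rfl⟩
  obtain ⟨Sg, hSg⟩ : ∃ f : ℝ → ℝ, f = fun N => ∑ 𝔲 ∈ boxG K k (paramW K N) (nfR K θ δ N),
      smoothY K k G (nfR K θ δ N) (paramW K N) 𝔲 ^ 2 / ∏ i, idealTotient K (𝔲 i) := ⟨_, rfl⟩
  obtain ⟨Sg', hSg'⟩ : ∃ f : ℝ → ℝ, f = fun N => ∑ 𝔲 ∈ boxG K k (paramW K N) (nfR K θ δ N),
      (maynardSimplex k).indicator G (fun i => Real.log (Ideal.absNorm (𝔲 i)) / Real.log (nfR K θ δ N)) ^ 2 /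
        ∏ i, idealTotient K (𝔲 i) := ⟨_, rfl⟩
  have hSS : ∀ N, Sg N = Sg' N := fun N => by
    rw [hSg, hSg']
    exact Finset.sum_congr rfl fun 𝔲 hu => by rw [smoothY_of_mem_boxG hu]
  obtain ⟨X, hX⟩ : ∃ f : ℝ → ℝ, f = fun N => (2 ^ finrank ℚ K - 1) * N ^ finrank ℚ K /
      (Ideal.absNorm (paramW K N) * √|(discr K : ℝ)|) := ⟨_, rfl⟩
  obtain ⟨Aw, hAw⟩ : ∃ f : ℝ → ℝ, f = fun N => (cardA K N : ℝ) / Ideal.absNorm (paramW K N) := ⟨_, rfl⟩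
  obtain ⟨Pk, hPk⟩ : ∃ f : ℝ → ℝ, f = fun N => (dedekindZeta_residue K *
      (∑ 𝔢 ∈ idealDivisors K (paramW K N), (idealMoebius 𝔢 : ℝ) / Ideal.absNorm 𝔢) *
        Real.log (nfR K θ δ N)) ^ k := ⟨_, rfl⟩
  have hMT : ∀ N, nfMainTerm K k θ δ N = Aw N * Pk N := fun N => by
    rw [hAw, hPk]
    beta_reduce
    rw [nfMainTerm_eq, dsum_paramW_eq]
  have hMTfun : nfMainTerm K k θ δ = fun N => Aw N * Pk N := funext hMT
  -- (1) Lemma 2.2: `S₁ − X Σ = o(𝔐)`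
  obtain ⟨g, hg, hev⟩ := eventually_abs_S1_sub_le (k := k) hinj hδ hη hθ hG v₀
  have e1 : (fun N => sieveS1 K k h θ δ G v₀ N - X N * Sg N) =o[atTop] nfMainTerm K k θ δ := by
    rw [Asymptotics.isLittleO_iff]
    intro c hc
    filter_upwards [hev, hg.eventually (eventually_le_nhds hc), eventually_nfMainTerm_pos (K := K) k hη]
      with N h1 h2 h3
    rw [Real.norm_eq_abs, Real.norm_eq_abs, abs_of_pos h3, hX, hSg]
    exact h1.trans (mul_le_mul_of_nonneg_right h2 h3.le)
  -- (2) the diagonal sum: `Σ' − Pk I = o(Pk)`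
  have ediag := diag_isLittleO hk hG (𝔴 := fun N => paramW K N) (D₀ := paramD0) (R := nfR K θ δ)
    (fun N => paramW_ne_bot N) tendsto_paramD0_atTop
    (fun N P hP hle => dvd_paramW_of_prime_of_absNorm_le hP hle) (tendsto_nfR_atTop hη)
    tendsto_eps_param (tendsto_E_param hη)
  rw [← hI] at ediag
  have ediag' : (fun N => Sg' N - Pk N * I) =o[atTop] Pk := by
    rw [hSg', hPk]; exact ediag
  -- (3) `(|A|/N𝔴)(Σ' − Pk I) = o(𝔐)`
  have e3 : (fun N => Aw N * (Sg' N - Pk N * I)) =o[atTop] nfMainTerm K k θ δ := by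
    rw [hMTfun]
    exact (isBigO_refl Aw atTop).mul_isLittleO ediag'
  -- (4) `(X − |A|/N𝔴) Σ = o(𝔐)`: `Σ' = O(Pk)`, `X − |A|/N𝔴 = o(1) · |A|/N𝔴`
  have hSgO : Sg' =O[atTop] Pk := by
    have h1 : (fun N => I * Pk N) =O[atTop] Pk := (isBigO_refl Pk atTop).const_mul_left I
    exact (ediag'.isBigO.add h1).congr_left fun N => by ring
  have hO : (fun N => Aw N * Sg' N) =O[atTop] nfMainTerm K k θ δ := by
    rw [hMTfun]; exact (isBigO_refl Aw atTop).mul hSgO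
  have ho : (fun N => (boxDensity K * (2 * N) ^ finrank ℚ K - cardA K N) / cardA K N) =o[atTop]
      (fun _ => (1 : ℝ)) :=
    (Asymptotics.isLittleO_one_iff ℝ).2 tendsto_boxDensity_ratio
  have e2 : (fun N => (X N - Aw N) * Sg N) =o[atTop] nfMainTerm K k θ δ := by
    have h1 := ho.mul_isBigO hO
    refine (h1.congr' ?_ ?_)
    · filter_upwards [(tendsto_cardA_atTop (K := K)).eventually_gt_atTop 0] with N hA
      have hw : (0 : ℝ) < Ideal.absNorm (paramW K N) := by
        exact_mod_cast Nat.pos_of_ne_zero (by rw [Ne, Ideal.absNorm_eq_zero_iff]; exact paramW_ne_bot N)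
      have hD : 0 < √|(discr K : ℝ)| := Real.sqrt_pos.2 (abs_pos.2 (Int.cast_ne_zero.2 (discr_ne_zero K)))
      rw [hSS N, hX, hAw]
      simp only []
      rw [← X_numerator_eq (K := K) N]
      field_simp
    · exact Eventually.of_forall fun N => one_mul _
  -- (5) combine
  have etot := (e1.add e2).add e3
  refine etot.congr' (Eventually.of_forall fun N => ?_) EventuallyEq.rfl
  beta_reduce
  rw [hMT N, ← hI, hSS N]
  ring

end Literature.NumberTheory.Sieve.MaynardNF
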